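import Summits.BirchSwinnertonDyer.Rank1Residual.X11a.ChainSocket
import Summits.BirchSwinnertonDyer.Rank1Residual.X11a.LambdaNormUnits
import Literature.NumberTheory.EllipticCurves.EmertonPollackWeston2006.WeightKMembers
import Literature.NumberTheory.EllipticCurves.Wan2015RationalMainConjecture
import Literature.NumberTheory.EllipticCurves.NonEisensteinPrimeOfSurjective
import HarnessLib

/-!
# Class X11a, surjective leaf, `p ≥ 5`: the chain DISCHARGED from the separate published facts
# (Hida ∘ Emerton–Pollack–Weston Thm 1 / 3.1.1 / 5.1.3 ∘ Wan Thm 4) — BSD(E,p) ⇐ PUB + existence of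
# the `p`-adic data + the per-pair certificate (cell `b2b-bsdres`, unit `b2b-bsdres-x11a`, gen 15)

HONEST FRAMING (run/shared/lean/b2b/bsd-rank1-residual/, verbatim in every file): the goal of the
cell is to DELETE the COMBINATION-SHAPED residual classes of the Birch–Swinnerton-Dyer formula for
ALL analytic-rank `≤ 1` elliptic curves over `ℚ` — "full BSD formula for every rank `≤ 1` curve in
class `C`" assembled STRICTLY from published theorems — so that the rank-`≤ 1` remainder becomes
exactly the CONSTRUCTION-SHAPED classes, which are TYPED (missing-input `Prop`s), NOT attempted.
This is not "finishing BSD". Research route; NO CLAIM BEYOND STATED CLASSES. Theorems only; every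
published input is an explicit NAMED-FACT hypothesis; three EXISTENCE inputs are explicit displayed
hypotheses (see below); the certificate is an explicit hypothesis.

THE RESULT (`forall_bsdp_of_facts`). For `E/ℚ`, `p` with `ClassX11a W p`, `p ≥ 5`, `ρ̄_{E,p}`
surjective: `MuAnZeroAt W p ⟹ BSD(E,p)`, from the NAMED FACTS
* [L1] `hida_exists_congruent_ordinary_newform_of_multiplicative` (Hida 1986 / EPW Thm 2.1.2),
* `exists_isCycPAdicLFunctionWeightK` (Mazur–Tate–Teitelbaum 1986 §I.14),
* `EmertonPollackWeston2006.thm311_cotorsion_weightK_member` (EPW Thm 3.1.1 [Kato]),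
* `EmertonPollackWeston2006.thm1_muAlg_of_weightK_member` (EPW Thm 1, `* = alg`, `f_E ↦ g`),
* `Wan2015.thm4_rational_weightK_member` (Wan 2015 Thm 4 = 103, rational part),
* `EmertonPollackWeston2006.thm513_transfer_from_weightK_member` (EPW Thm 5.1.3 + 4.4.5, `g ↦ f_E`),
* Kato–Wuthrich A32, Stein–Wuthrich Thm 6.1 + canonical heights, GZK, modularity, Greenberg–Stevens,
and THREE EXISTENCE INPUTS displayed as hypotheses (published, not yet vendored as facts):
(E1) ordinary `p`-adic data for every ordinary member — unit root (proved here: `exists_unitRoot`)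
+ an integral model of `ρ_{g,ι}` over `𝒪` (Deligne 1971 / Deligne–Serre Thm 6.1 + a stable lattice)
+ the ordinary filtration (Wiles 1988 Thm 2.2) = `Nonempty (OrdinaryPadicData g p ι)`;
(E2) a `Λ_𝒪`-dual datum of Greenberg's Selmer group exists (Pontryagin duality; Greenberg 1989 §1);
(E3) the characteristic ideal of a torsion dual is principal (structure theory of `Λ_𝒪`-modules;
EPW §5.1 "`L_p^alg(f)` a generator of the characteristic power series").
So X11a ∩ {`p ≥ 5`, `ρ̄` surjective} = PUB + (E1)–(E3) + per-pair certificate; class-level residue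
= Greenberg's `μ`-conjecture (NAMED, OPEN; typed `X11a.MuAnZeroAt`). No label change by this file.

Mechanism: `Chain.invariantsAt_normLam_of_facts` runs the socket's proof with the concrete
Greenberg–Selmer vocabulary (`GreenbergSelmerNewform.lean`, harvest-2; `NewformPadicIntegralModel.lean`):
member `g` (T3′) → data `𝔇` (E1) → Shimura datum (proved) → THE `L` (MTT fact) → for the conclusion's
own cyclotomic `(κ, γ)`: dual datum `D` (E2), torsion (Thm 3.1.1), generator `G` (E3) →
`μ^alg(g) = 0` (Thm 1 from [L4] `μ(X(E/ℚ_∞)) = 0`, `X11a/MuZero.lean`) → `L = c·u·G` (Wan) ⇒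
`normLam G = normLam L` (`LambdaNorm.normLam_mul_of_integral_unit`, `normLam_C_mul`) → Thm 5.1.3
(+ 4.4.5 with the certificate) ⇒ `InvariantsAt W p (unit contents ∧ normLam gK = normLam fE)` →
`X11a/NormLamEndpoint.lean` ⇒ `BSD(E,p)`.

References: [EmertonPollackWeston2006] Thm. 1, 3.1.1, 4.4.5, 5.1.3, Def. 4.4.6; [Wan2015] Thm. 4;
[Hida1986]; [MazurTateTeitelbaum1986] §I.14; HOME/b2b-bsdres-x11a/X11A-CHAIN.md;
HOME/b2b-bsdres-lit/g14/X11A-AUDIT.md; review of p204620 (assembled fact refused ⇒ this discharge).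
-/

noncomputable section

open scoped Classical MatrixGroups ModularForm

open CongruenceSubgroup WeierstrassCurve Literature.NumberTheory.EllipticCurves
  Literature.NumberTheory.EllipticCurves.ModularForms
  Literature.NumberTheory.EllipticCurves.Rank1Residual
  Literature.NumberTheory.EllipticCurves.Rank1Residual.Typed
  Literature.NumberTheory.EllipticCurves.Wuthrich2014
  Literature.NumberTheory.EllipticCurves.SteinWuthrich2013
  Literature.NumberTheory.EllipticCurves.GreenbergVatsal2000
  Literature.NumberTheory.EllipticCurves.EmertonPollackWeston2006
  Summit.BirchSwinnertonDyer.Rank1Residual.X1.MuLambda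
  Summit.BirchSwinnertonDyer.Rank1Residual.X11a.LambdaNorm

set_option autoImplicit false

namespace Summit.BirchSwinnertonDyer.Rank1Residual.X11a.Chain

/-! ### Norm bookkeeping for `𝒪 ⊆ ℚ̄_p` -/

section Integers

variable {p : ℕ} [Fact p.Prime] {S : Set (PadicAlgCl p)}

/-- Elements of `𝒪 = {x ∈ ℚ_p(S) : |x| ≤ 1}` have norm `≤ 1`. [folklore] -/
theorem norm_coe_le_one (x : padicCoeffIntegers S) : ‖(x : PadicAlgCl p)‖ ≤ 1 := x.2.2

/-- Units of `𝒪` have norm `1`. [folklore] -/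
theorem norm_coe_eq_one_of_isUnit {x : padicCoeffIntegers S} (hx : IsUnit x) :
    ‖(x : PadicAlgCl p)‖ = 1 := by
  obtain ⟨y, hy⟩ := hx.exists_right_inv
  have h1 : ‖(x : PadicAlgCl p)‖ * ‖(y : PadicAlgCl p)‖ = 1 := by
    rw [← norm_mul, ← Subring.coe_mul, hy, Subring.coe_one, norm_one]
  have ha := norm_coe_le_one x
  have hb := norm_coe_le_one y
  nlinarith [norm_nonneg (x : PadicAlgCl p), norm_nonneg (y : PadicAlgCl p)]

/-- The image in `ℚ̄_p⟦T⟧` of a unit of `Λ_𝒪 = 𝒪⟦T⟧` has unit constant term and integral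
coefficients. [folklore] -/
theorem map_unit_integral (u : (PowerSeries (padicCoeffIntegers S))ˣ) :
    ‖PowerSeries.constantCoeff
        (PowerSeries.map (padicCoeffIntegers S).subtype (u : PowerSeries (padicCoeffIntegers S)))‖ = 1 ∧
      ∀ i, ‖PowerSeries.coeff i
        (PowerSeries.map (padicCoeffIntegers S).subtype (u : PowerSeries (padicCoeffIntegers S)))‖ ≤ 1 := by
  refine ⟨?_, fun i => ?_⟩
  · rw [← PowerSeries.coeff_zero_eq_constantCoeff_apply, PowerSeries.coeff_map,
      PowerSeries.coeff_zero_eq_constantCoeff_apply]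
    exact norm_coe_eq_one_of_isUnit (PowerSeries.isUnit_constantCoeff _ u.isUnit)
  · rw [PowerSeries.coeff_map]
    exact norm_coe_le_one _

/-- A series over `𝒪` with a coefficient of norm `1` attains its maximal norm (in `ℚ̄_p⟦T⟧`) and has a
non-zero coefficient. [folklore] -/
theorem hasMaxCoeff_map_of_exists_norm_eq_one {G : PowerSeries (padicCoeffIntegers S)}
    (h : ∃ n, ‖((PowerSeries.coeff n G : padicCoeffIntegers S) : PadicAlgCl p)‖ = 1) :
    HasMaxCoeff (PowerSeries.map (padicCoeffIntegers S).subtype G) ∧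
      ∃ n, ‖PowerSeries.coeff n (PowerSeries.map (padicCoeffIntegers S).subtype G)‖ ≠ 0 := by
  obtain ⟨n, hn⟩ := h
  refine ⟨⟨n, fun m => ?_⟩, ⟨n, ?_⟩⟩
  · rw [PowerSeries.coeff_map, PowerSeries.coeff_map, Subring.subtype_apply, Subring.subtype_apply, hn]
    exact norm_coe_le_one _
  · rw [PowerSeries.coeff_map, Subring.subtype_apply, hn]; exact one_ne_zero

end Integers

/-! ### The discharge -/

section Discharge

variable (W : WeierstrassCurve ℚ) [W.IsElliptic] [W.IsGloballyMinimal] (p : ℕ) [Fact p.Prime]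

/-- **The chain at a pair, from the separate published facts.** Hypotheses: the named facts listed in
the module docstring; the existence inputs (E1) `hData`, (E2) `hDual`, (E3) `hGen` (displayed); a
multiplicative `p ≥ 5` with `ρ̄_{E,p}` surjective and the certificate `MuAnZeroAt W p`. Conclusion:
every Kato pair has unit contents and `normLam gK = normLam fE`.
[cite: EmertonPollackWeston2006, Thm. 1, Thm. 3.1.1, Thm. 5.1.3] [cite: Wan2015, Thm. 4] -/
theorem invariantsAt_normLam_of_facts [NeZero (W.conductorNorm ℤ / p)]
    (hHida : hida_exists_congruent_ordinary_newform_of_multiplicative)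
    (hMTT : exists_isCycPAdicLFunctionWeightK)
    (h311 : thm311_cotorsion_weightK_member) (hT1a : thm1_muAlg_of_weightK_member)
    (hT2 : Wan2015.thm4_rational_weightK_member) (hT1b : thm513_transfer_from_weightK_member)
    (hKato : kato_charIdeal_dvd_multiplicative_of_surjective)
    (hpar : nonempty_modularParametrizationData)
    (hData : ∀ {k : ℤ} (g : CuspForm (Gamma0 (W.conductorNorm ℤ / p)) k)
      (ι : coeffField g →+* PadicAlgCl p), IsOrdinaryMemberOf W p g ι →
      Nonempty (OrdinaryPadicData g p ι))
    (hDual : ∀ {k : ℤ} (g : CuspForm (Gamma0 (W.conductorNorm ℤ / p)) k)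
      (ι : coeffField g →+* PadicAlgCl p), IsOrdinaryMemberOf W p g ι →
      ∀ (𝔇 : OrdinaryPadicData g p ι) (κ : ZpExtension ℚ p)
      (γ : Field.absoluteGaloisGroup ℚ), κ.IsCyclotomic → κ.IsTopGenerator γ →
      Nonempty (GreenbergSelmer.DualData (padicCoeffField (memberGenerators g ι 𝔇.υ)) κ γ 𝔇.ρ 𝔇.plus))
    (hGen : ∀ {k : ℤ} (g : CuspForm (Gamma0 (W.conductorNorm ℤ / p)) k)
      (ι : coeffField g →+* PadicAlgCl p), IsOrdinaryMemberOf W p g ι →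
      ∀ (𝔇 : OrdinaryPadicData g p ι) (κ : ZpExtension ℚ p)
      (γ : Field.absoluteGaloisGroup ℚ), κ.IsCyclotomic → κ.IsTopGenerator γ →
      ∀ (D : GreenbergSelmer.DualData (padicCoeffField (memberGenerators g ι 𝔇.υ)) κ γ 𝔇.ρ 𝔇.plus),
      Module.Finite (PowerSeries (padicCoeffIntegers (memberGenerators g ι 𝔇.υ))) D.X →
      Module.IsTorsion (PowerSeries (padicCoeffIntegers (memberGenerators g ι 𝔇.υ))) D.X →
      ∃ G, D.charIdeal = Ideal.span {G})
    (hp : 5 ≤ p) (hmult : W.HasMultiplicativeReductionAtPrime p)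
    (hsurj : W.HasSurjectiveModNGaloisRep p) (hμ : MuAnZeroAt W p) :
    InvariantsAt W p fun gK fE => HasUnitContent gK ∧ HasUnitContent fE ∧ normLam gK = normLam fE := by
  have hprime : p.Prime := Fact.out
  have hp2 : p ≠ 2 := by omega
  haveI : NeZero p := ⟨hprime.ne_zero⟩
  have hirr : W.HasIrreducibleModPGaloisRep p :=
    hasIrreducibleModPGaloisRep_of_hasSurjectiveModNGaloisRep W p hsurj
  have hpM : ¬ p ∣ W.conductorNorm ℤ / p := not_dvd_conductorNorm_div W p hmult
  -- [L1]: the weight-`k` member, `k = (p − 1) + 2`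
  set n : ℕ := p - 1 with hn
  have hn0 : n ≠ 0 := by omega
  have hneven : Even n := hn ▸ hprime.even_sub_one hp2
  have hk2 : (2 : ℤ) < (n : ℤ) + 2 := by omega
  have hkdvd : ((p : ℤ) - 1) ∣ ((n : ℤ) + 2 - 2) := by
    refine ⟨1, ?_⟩
    rw [hn, Nat.cast_sub hprime.one_le]; push_cast; ring
  obtain ⟨g, ι, hg, hap, hcong⟩ := hHida W p hp hmult inferInstance ((n : ℤ) + 2) hk2 hkdvd
  have hmem : IsOrdinaryMemberOf W p g ι := ⟨hk2, hkdvd, hg, hap, hcong⟩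
  -- (E1) the ordinary `p`-adic data; Shimura's datum; THE `p`-adic `L`-function
  obtain ⟨𝔇⟩ := hData g ι hmem
  obtain ⟨Dsym⟩ := IsNewform0.nonempty_periodSymbolDatum hneven hn0 hg
  obtain ⟨L, hL, -, -⟩ := hMTT g hg (by omega) p hpM ι 𝔇.υ 𝔇.υ_root 𝔇.norm_υ Dsym
  -- [L4]: `μ(X(E/ℚ_∞)) = 0` for every cyclotomic / dual datum, from the certificate
  have hμalg : ∀ (κ : ZpExtension ℚ p) (γ : Field.absoluteGaloisGroup ℚ), κ.IsCyclotomic →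
      κ.IsTopGenerator γ → IsCyclotomicVariable p γ →
      ∀ D' : W.SelmerDualData κ γ, D'.IsTorsion ∧ D'.mu = 0 :=
    fun κ γ hκ hγ hγ' D' =>
      ⟨(isTorsion_and_exists_generator_hasUnitContent_of_muAnZeroAt W p hKato hpar hp hmult hsurj hμ
          hκ hγ hγ' D').1,
        selmerDual_mu_eq_zero_of_muAnZeroAt W p hKato hpar hp hmult hsurj hμ hκ hγ hγ' D'⟩
  -- the conclusion's own cyclotomic datum serves the `g`-side
  intro κ γ hκ hγ hγ' N _ f hf D' ϖ hϖ fE gK hchar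
  obtain ⟨D⟩ := hDual g ι hmem 𝔇 κ γ hκ hγ
  obtain ⟨hfin, htors⟩ := h311 W p hp hmult hirr g ι hmem 𝔇 κ γ hκ hγ D
  obtain ⟨G, hG⟩ := hGen g ι hmem 𝔇 κ γ hκ hγ D hfin htors
  -- EPW Thm. 1 (alg): `μ^alg(g) = 0`
  have hμg := hT1a W p hp hmult hirr hμalg g ι hmem 𝔇 κ γ hκ hγ hγ' D htors G hG
  -- Wan Thm. 4: `L = c · u · G`, hence `λ^alg(g) = λ^an(g)`
  obtain ⟨c, u, hc, hLcuG⟩ :=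
    hT2 W p hp hmult hsurj hpM g ι hmem 𝔇 κ γ hκ hγ hγ' D htors G hG Dsym L hL
  have hlam : normLam (PowerSeries.map (padicCoeffIntegers (memberGenerators g ι 𝔇.υ)).subtype G) =
      normLam L := by
    obtain ⟨hU0, hU⟩ := map_unit_integral u
    obtain ⟨hGmax, hG0⟩ := hasMaxCoeff_map_of_exists_norm_eq_one hμg
    rw [hLcuG, normLam_C_mul (norm_ne_zero_iff.mpr hc), map_mul,
      normLam_mul_of_integral_unit hU0 hU hGmax hG0]
  -- EPW Thm. 5.1.3 (+ 4.4.5 with the certificate), at the Kato pair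
  exact hT1b W p hp hmult hirr g ι hmem 𝔇 κ γ hκ hγ hγ' D htors G hG Dsym L hL hμg hlam hμ κ γ hκ hγ
    hγ' f hf D' ϖ hϖ fE gK hchar

/-- **`BSD(E,p)` at a pair of X11a's surjective leaf, from the separate published facts**
(`r_an = 0`; socket `bsdp_of_invariantsAt_normLam`). [cite: EmertonPollackWeston2006, Thm. 5.1.3]
[cite: Wan2015, Thm. 4] [cite: SteinWuthrich2013, Thm. 6.1 (p. 20)] -/
theorem bsdp_of_facts [NeZero (W.conductorNorm ℤ / p)]
    (hHida : hida_exists_congruent_ordinary_newform_of_multiplicative)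
    (hMTT : exists_isCycPAdicLFunctionWeightK)
    (h311 : thm311_cotorsion_weightK_member) (hT1a : thm1_muAlg_of_weightK_member)
    (hT2 : Wan2015.thm4_rational_weightK_member) (hT1b : thm513_transfer_from_weightK_member)
    (hKato : kato_charIdeal_dvd_multiplicative_of_surjective)
    (hJs : thm61_splitMultiplicative) (hJn : thm61_nonsplitMultiplicative)
    (hHs : exists_isSplitMultCanonical) (hHn : exists_isMultCanonical)
    (hGZK : rank_eq_analyticRank_of_analyticRank_le_one) (hmod : hasEntireLFunction_rat)
    (hpar : nonempty_modularParametrizationData)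
    (hGS : greenberg_stevens (W := W) (p := p))
    (hData : ∀ {k : ℤ} (g : CuspForm (Gamma0 (W.conductorNorm ℤ / p)) k)
      (ι : coeffField g →+* PadicAlgCl p), IsOrdinaryMemberOf W p g ι →
      Nonempty (OrdinaryPadicData g p ι))
    (hDual : ∀ {k : ℤ} (g : CuspForm (Gamma0 (W.conductorNorm ℤ / p)) k)
      (ι : coeffField g →+* PadicAlgCl p), IsOrdinaryMemberOf W p g ι →
      ∀ (𝔇 : OrdinaryPadicData g p ι) (κ : ZpExtension ℚ p)
      (γ : Field.absoluteGaloisGroup ℚ), κ.IsCyclotomic → κ.IsTopGenerator γ →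
      Nonempty (GreenbergSelmer.DualData (padicCoeffField (memberGenerators g ι 𝔇.υ)) κ γ 𝔇.ρ 𝔇.plus))
    (hGen : ∀ {k : ℤ} (g : CuspForm (Gamma0 (W.conductorNorm ℤ / p)) k)
      (ι : coeffField g →+* PadicAlgCl p), IsOrdinaryMemberOf W p g ι →
      ∀ (𝔇 : OrdinaryPadicData g p ι) (κ : ZpExtension ℚ p)
      (γ : Field.absoluteGaloisGroup ℚ), κ.IsCyclotomic → κ.IsTopGenerator γ →
      ∀ (D : GreenbergSelmer.DualData (padicCoeffField (memberGenerators g ι 𝔇.υ)) κ γ 𝔇.ρ 𝔇.plus),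
      Module.Finite (PowerSeries (padicCoeffIntegers (memberGenerators g ι 𝔇.υ))) D.X →
      Module.IsTorsion (PowerSeries (padicCoeffIntegers (memberGenerators g ι 𝔇.υ))) D.X →
      ∃ G, D.charIdeal = Ideal.span {G})
    (hp : 5 ≤ p) (hmult : W.HasMultiplicativeReductionAtPrime p)
    (hsurj : W.HasSurjectiveModNGaloisRep p) (hr : W.analyticRank = 0) (hμ : MuAnZeroAt W p) :
    BSDp W p :=
  bsdp_of_invariantsAt_normLam W p hKato hJs hJn hHs hHn hGZK hmod hpar hGS hp hmult hsurj hr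
    (invariantsAt_normLam_of_facts W p hHida hMTT h311 hT1a hT2 hT1b hKato hpar hData hDual hGen hp
      hmult hsurj hμ)

end Discharge

end Summit.BirchSwinnertonDyer.Rank1Residual.X11a.Chain

/-! ### Class level -/

namespace Summit.BirchSwinnertonDyer.Rank1Residual.X11a

open Chain

/-- **X11a ∩ {`p ≥ 5`, `ρ̄_{E,p}` surjective}: `BSD(E,p)` ⇐ PUBLISHED facts + existence of the
`p`-adic data (E1)–(E3) + the per-pair certificate `μ^an(E,p) = 0`** — the published facts being
Hida's member, Mazur–Tate–Teitelbaum, EPW 2006 Thm 1 / 3.1.1 / 5.1.3 (+4.4.5), Wan 2015 Thm 4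
(rational), Kato–Wuthrich A32, Stein–Wuthrich Thm 6.1 + heights, Greenberg–Stevens, GZK, modularity
(all NAMED facts, explicit), and (E1)–(E3) displayed (Deligne + Wiles data; Pontryagin dual;
principal generator). Class-level residue: Greenberg's `μ`-conjecture (typed: `X11a.MuAnZeroAt`).
No label change is made by this theorem (the cell lead / referee decide; flags on the facts:
`Wan15-Thm103-Fujiwara`, `EPW-canonical-period`). [cite: EmertonPollackWeston2006, Thm. 1, Thm. 5.1.3]
[cite: Wan2015, Thm. 4] [cite: SteinWuthrich2013, Thm. 6.1 (p. 20)] -/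
theorem forall_bsdp_of_facts
    (hHida : hida_exists_congruent_ordinary_newform_of_multiplicative)
    (hMTT : exists_isCycPAdicLFunctionWeightK)
    (h311 : thm311_cotorsion_weightK_member) (hT1a : thm1_muAlg_of_weightK_member)
    (hT2 : Wan2015.thm4_rational_weightK_member) (hT1b : thm513_transfer_from_weightK_member)
    (hKato : kato_charIdeal_dvd_multiplicative_of_surjective)
    (hJs : thm61_splitMultiplicative) (hJn : thm61_nonsplitMultiplicative)
    (hHs : exists_isSplitMultCanonical) (hHn : exists_isMultCanonical)
    (hGZK : rank_eq_analyticRank_of_analyticRank_le_one) (hmod : hasEntireLFunction_rat)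
    (hpar : nonempty_modularParametrizationData)
    (hGS : ∀ (W : WeierstrassCurve ℚ) [W.IsElliptic] [W.IsGloballyMinimal] (p : ℕ) [Fact p.Prime],
      greenberg_stevens (W := W) (p := p))
    (hData : ∀ (W : WeierstrassCurve ℚ) [W.IsElliptic] [W.IsGloballyMinimal] (p : ℕ) [Fact p.Prime]
      [NeZero (W.conductorNorm ℤ / p)] {k : ℤ} (g : CuspForm (Gamma0 (W.conductorNorm ℤ / p)) k)
      (ι : coeffField g →+* PadicAlgCl p), IsOrdinaryMemberOf W p g ι →
      Nonempty (OrdinaryPadicData g p ι))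
    (hDual : ∀ (W : WeierstrassCurve ℚ) [W.IsElliptic] [W.IsGloballyMinimal] (p : ℕ) [Fact p.Prime]
      [NeZero (W.conductorNorm ℤ / p)] {k : ℤ} (g : CuspForm (Gamma0 (W.conductorNorm ℤ / p)) k)
      (ι : coeffField g →+* PadicAlgCl p), IsOrdinaryMemberOf W p g ι →
      ∀ (𝔇 : OrdinaryPadicData g p ι) (κ : ZpExtension ℚ p)
      (γ : Field.absoluteGaloisGroup ℚ), κ.IsCyclotomic → κ.IsTopGenerator γ →
      Nonempty (GreenbergSelmer.DualData (padicCoeffField (memberGenerators g ι 𝔇.υ)) κ γ 𝔇.ρ 𝔇.plus))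
    (hGen : ∀ (W : WeierstrassCurve ℚ) [W.IsElliptic] [W.IsGloballyMinimal] (p : ℕ) [Fact p.Prime]
      [NeZero (W.conductorNorm ℤ / p)] {k : ℤ} (g : CuspForm (Gamma0 (W.conductorNorm ℤ / p)) k)
      (ι : coeffField g →+* PadicAlgCl p), IsOrdinaryMemberOf W p g ι →
      ∀ (𝔇 : OrdinaryPadicData g p ι) (κ : ZpExtension ℚ p)
      (γ : Field.absoluteGaloisGroup ℚ), κ.IsCyclotomic → κ.IsTopGenerator γ →
      ∀ (D : GreenbergSelmer.DualData (padicCoeffField (memberGenerators g ι 𝔇.υ)) κ γ 𝔇.ρ 𝔇.plus),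
      Module.Finite (PowerSeries (padicCoeffIntegers (memberGenerators g ι 𝔇.υ))) D.X →
      Module.IsTorsion (PowerSeries (padicCoeffIntegers (memberGenerators g ι 𝔇.υ))) D.X →
      ∃ G, D.charIdeal = Ideal.span {G}) :
    ∀ (W : WeierstrassCurve ℚ) [W.IsElliptic] [W.IsGloballyMinimal] (p : ℕ) [Fact p.Prime],
      ClassX11a W p → 5 ≤ p → Surj W p → MuAnZeroAt W p → BSDp W p := by
  intro W _ _ p _ hX hp hsurj hμ
  haveI : NeZero (W.conductorNorm ℤ / p) := neZero_conductorNorm_div W p hX.2.2.1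
  exact bsdp_of_facts W p hHida hMTT h311 hT1a hT2 hT1b hKato hJs hJn hHs hHn hGZK hmod hpar (hGS W p)
    (hData W p) (hDual W p) (hGen W p) hp hX.2.2.1 hsurj hX.1 hμ


end Summit.BirchSwinnertonDyer.Rank1Residual.X11a

end
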